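import Summits.Ventures.WeilGRH.KeyWindowDilation
import Summits.Ventures.WeilGRH.TwistedWindowForm
import HarnessLib

/-!
# The section door for KEYS: positivity of all trigonometric sections ⇒ `WeilPositivityOnKey`

Cell `rh-explicit`, WEIL TRACK — GRH ARM (weil-grh-5; `GRH-LIT-AS-PRINTED.md` A36/A37).  weil-grh-1's dictionary
`weilPositivityOnChar_of_twistedWindowForm_sum_chi_nonneg` (TwistedWindowForm.lean) turns «every twisted
trigonometric section `Σ_{|n|≤N} c_n χ_n` of Yoshida's `K(a)` has a non-negative twisted window form» into the rung
`WeilPositivityOnChar χ a` — for CHARACTERS.  The pseudo-key certificates of the arm (weil-grh-2's all-trivial key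
`v = 1`, the universal minorant of its parity class: `KeyMinorant.lean`, `KeyMinorantParity.lean`) live at KEYS
`(a, L, v)` that no character need realise.  This file is the key-level door:

* `tendsto_keyMarkovForm_proj` — continuity of the key form `keyMarkovForm a L v c` along the Fourier
  truncations `proj b N φ` of any `φ ∈ K(b)` (the truncations are a uniformly convergent window family with a
  uniform Lipschitz bound: `Yoshida1992.norm_sub_trigPoly_le`, `norm_trigPolyDeriv_le`, fed to
  `tendsto_keyMarkovForm_of_uniform` of `KeyWindowDilation.lean`);
* `keyMarkovForm_nonneg_of_forall_section_nonneg` — if `0 ≤ keyMarkovForm a L v c (Σ_{|n|≤N} x_n χ_n)` for all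
  `N`, `x`, then `0 ≤ keyMarkovForm a L v c φ` for every `φ ∈ K(b)`;
* `weilPositivityOnKey_of_forall_section_nonneg` — with `b = c = t_{N'} = log(N'+1)/2`: positivity of the key
  form on all trigonometric sections of `K(t_{N'})` gives `WeilPositivityOnKey a L v N'` (`a ≤ 1`); composed with
  `weilPositivityOnChar_of_weilPositivityOnKey_allTrivial_le` (KeyWindowDilation) /
  `weilPositivityOnChar_of_allTrivial_even_key_nonneg` (KeyMinorantParity), ONE such statement at the all-trivial
  key of conductor `q₀` is a rung for every Dirichlet character of every modulus `q ≥ q₀`.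

What is NOT here: the finite-certificate ⇒ «all sections» step (Schur complement + tail coercivity of the sections
beyond the certified block — rh-explicit-moll-step0-1's chain (Z2)–(Z6), untyped), and the converse at the same
window for sections with edge jumps (typed for characters in weil-3's `TwistedWindowClosure.lean`).  Everything is
proved; no definitions, no named facts, RH/GRH-free.
[cite: Yoshida1992, §0 p. 282 (the form on K(a)) and §3 p. 289 (Fourier expansion on K(a));
Weil1952FormulesExplicites, (11) pp. 261–262]
-/

set_option autoImplicit false

noncomputable section

open Complex Filter Set MeasureTheory
open scoped Real Topology ComplexConjugate ArithmeticFunction.vonMangoldt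

namespace Summit.Ventures.WeilGRH

open Literature.NumberTheory.LFunctions
open Literature.NumberTheory.LFunctions.Yoshida1992 (modes chi proj trigPoly trigPolyDeriv
  proj_apply_of_mem proj_apply_of_not_mem proj_apply_eq_indicator_trigPoly norm_trigPoly_le
  norm_trigPoly_sub_le norm_trigPolyDeriv_le norm_sub_trigPoly_le tendsto_tsum_compl_modes
  summable_pow_mul_norm_fourierCoeff)
open Summit.RiemannHypothesis.RiemannHypothesis.Theorems.WeilFormatC

variable {b : ℝ} {φ : ℝ → ℂ}

/-- **Continuity of the key form along Fourier truncation on Yoshida's `K(b)`** (`b > 0`): for `φ ∈ K(b)` and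
every `(a, L, v, c)`, `keyMarkovForm a L v c (proj b N φ) → keyMarkovForm a L v c φ`.  (The bookkeeping of
weil-grh-1's `tendsto_twistedWindowForm_proj`, verbatim, into `tendsto_keyMarkovForm_of_uniform`.)
[cite: Yoshida1992, §3 p. 289] -/
theorem tendsto_keyMarkovForm_proj (hb : 0 < b) (hφ : φ ∈ Yoshida1992.K b) (a : ℕ) (L : ℝ) (v : ℕ → ℂ)
    (c : ℝ) :
    Tendsto (fun N ↦ keyMarkovForm a L v c (proj b N φ)) atTop (𝓝 (keyMarkovForm a L v c φ)) := by
  have hsum0 : Summable fun n : ℤ ↦ ‖Yoshida1992.fourierCoeff b n φ‖ := by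
    simpa using summable_pow_mul_norm_fourierCoeff hb hφ 0
  have hsum1 := summable_pow_mul_norm_fourierCoeff hb hφ 1
  have hcont : ∀ N, Continuous (trigPoly b N φ) := fun N ↦
    continuous_finsetSum _ fun n _ ↦ continuous_const.mul
      (Complex.continuous_exp.comp ((continuous_const.mul Complex.continuous_ofReal).div_const _))
  refine tendsto_keyMarkovForm_of_uniform (w := fun N ↦ proj b N φ)
    (S₀ := ∑' n : ℤ, ‖Yoshida1992.fourierCoeff b n φ‖ / (2 * b))
    (S₁ := (π / b / (2 * b)) * ∑' n : ℤ, |(n : ℝ)| ^ 1 * ‖Yoshida1992.fourierCoeff b n φ‖)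
    (δ := fun N ↦ ∑' n : {n // n ∉ modes N}, ‖Yoshida1992.fourierCoeff b n φ‖ / (2 * b))
    hb (fun N ↦ ?_) (fun N x hx ↦ proj_apply_of_not_mem hb N φ hx) (fun N x ↦ ?_)
    (fun N x y hx hy ↦ ?_) (fun N x ↦ ?_) (tendsto_tsum_compl_modes b φ) a L v c
  · have : proj b N φ = (Icc (-b) b).indicator (trigPoly b N φ) :=
      funext fun x ↦ proj_apply_eq_indicator_trigPoly hb N φ x
    rw [this]
    exact (hcont N).measurable.indicator measurableSet_Icc
  · by_cases hx : x ∈ Icc (-b) b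
    · rw [proj_apply_of_mem hb N φ hx]
      exact norm_trigPoly_le hb hsum0 N x
    · rw [proj_apply_of_not_mem hb N φ hx, norm_zero]
      exact tsum_nonneg fun n ↦ by positivity
  · rw [proj_apply_of_mem hb N φ hx, proj_apply_of_mem hb N φ hy]
    exact norm_trigPoly_sub_le (fun z ↦ norm_trigPolyDeriv_le hb hsum1 N z) x y
  · by_cases hx : x ∈ Icc (-b) b
    · rw [proj_apply_of_mem hb N φ hx, norm_sub_rev]
      exact norm_sub_trigPoly_le hb hφ N hx
    · rw [proj_apply_of_not_mem hb N φ hx,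
        Yoshida1992.eq_zero_of_mem_K hφ (lt_abs_of_not_mem_Icc_window hx), sub_zero, norm_zero]
      exact tsum_nonneg fun n ↦ by positivity

/-- **Positivity on the trigonometric sections ⇒ positivity of the key form on all of `K(b)`** (`b > 0`; any key
`(a, L, v)` and any window parameter `c`). [cite: Yoshida1992, §0 p. 282 and §3 p. 289] -/
theorem keyMarkovForm_nonneg_of_forall_section_nonneg (hb : 0 < b) {a : ℕ} {L : ℝ} {v : ℕ → ℂ} {c : ℝ}
    (h : ∀ (N : ℕ) (x : ℤ → ℂ), 0 ≤ keyMarkovForm a L v c (∑ n ∈ modes N, x n • chi b n))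
    (hφ : φ ∈ Yoshida1992.K b) :
    0 ≤ keyMarkovForm a L v c φ :=
  ge_of_tendsto' (tendsto_keyMarkovForm_proj hb hφ a L v c) fun N ↦
    h N fun n ↦ (((1 / Real.sqrt (2 * b) : ℝ) : ℂ) * Yoshida1992.fourierCoeff b n φ)

/-- **THE SECTION DOOR FOR KEYS.**  `a ≤ 1`, `N' ≥ 1`, `t = log(N'+1)/2`: if the key form of `(a, L, v)` at window
`t` is non-negative on every trigonometric section `Σ_{|n|≤N} x_n χ_n` of `K(t)` (all `N`, all `x : ℤ → ℂ`), then
`WeilPositivityOnKey a L v N'`.  (Test functions on `[−t, t]` lie in `C(t) ⊆ K(t)`.)  With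
`weilPositivityOnChar_of_weilPositivityOnKey_allTrivial_le` / `weilPositivityOnChar_of_allTrivial_even_key_nonneg`,
one such statement at the all-trivial key `(a, log q₀, 1)` is the rung `t` for every Dirichlet character of
parity `a` (resp. of either parity, for `a = 0`) and every modulus `q ≥ q₀`.
[cite: Yoshida1992, §0 p. 282; Weil1952FormulesExplicites, (11) pp. 261–262] -/
theorem weilPositivityOnKey_of_forall_section_nonneg {a : ℕ} (ha : a ≤ 1) (L : ℝ) (v : ℕ → ℂ) {N' : ℕ}
    (hN' : 1 ≤ N')
    (h : ∀ (N : ℕ) (x : ℤ → ℂ), 0 ≤ keyMarkovForm a L v (Real.log ((N' : ℝ) + 1) / 2)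
      (∑ n ∈ modes N, x n • chi (Real.log ((N' : ℝ) + 1) / 2) n)) :
    WeilPositivityOnKey a L v N' := by
  have ht0 : 0 < Real.log ((N' : ℝ) + 1) / 2 := by
    have h1 : (1 : ℝ) < (N' : ℝ) + 1 := by
      have : (1 : ℝ) ≤ (N' : ℝ) := by exact_mod_cast hN'
      linarith
    exact div_pos (Real.log_pos h1) two_pos
  rw [weilPositivityOnKey_iff_keyMarkovForm_nonneg ha L v N']
  intro g hg hsupp
  exact keyMarkovForm_nonneg_of_forall_section_nonneg ht0 h (Yoshida1992.C_le_K ht0 ⟨hg, hsupp⟩)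

/-- Section form: the same door with the hypothesis written on the SECTION GRAM MATRIX
`G_v(m, n) = keyWindowSesq a L v t (χ_m, χ_n)` — «all finite hermitian sections `(G_v(m,n))_{|m|,|n|≤N}` are
positive semidefinite» ⇒ `WeilPositivityOnKey a L v N'`. [cite: Yoshida1992, §5 (5.13)–(5.16)] -/
theorem weilPositivityOnKey_of_forall_sectionGram_nonneg {a : ℕ} (ha : a ≤ 1) (L : ℝ) (v : ℕ → ℂ) {N' : ℕ}
    (hN' : 1 ≤ N')
    (h : ∀ (N : ℕ) (x : ℤ → ℂ), 0 ≤ (∑ m ∈ modes N, ∑ n ∈ modes N, x m * conj (x n) *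
      keyWindowSesq a L v (Real.log ((N' : ℝ) + 1) / 2)
        (chi (Real.log ((N' : ℝ) + 1) / 2) m) (chi (Real.log ((N' : ℝ) + 1) / 2) n)).re) :
    WeilPositivityOnKey a L v N' := by
  have ht0 : 0 < Real.log ((N' : ℝ) + 1) / 2 := by
    have h1 : (1 : ℝ) < (N' : ℝ) + 1 := by
      have : (1 : ℝ) ≤ (N' : ℝ) := by exact_mod_cast hN'
      linarith
    exact div_pos (Real.log_pos h1) two_pos
  refine weilPositivityOnKey_of_forall_section_nonneg ha L v hN' fun N x ↦ ?_
  rw [keyMarkovForm_sum_smul_chi ht0 (modes N) x a L v]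
  exact h N x

end Summit.Ventures.WeilGRH

end
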